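import Summits.Ventures.LatticeQCDFlow.Scoring.PairedDrawAcceptance
import Summits.Ventures.LatticeQCDFlow.Scoring.AcceptanceMonitorConcentration
import HarnessLib

/-!
# The acceptance column from paired model draws, II: the PRINTED (scale-free) ratio with
# unnormalised weights — an exponential certificate

HONEST FRAMING: exact (Metropolis-corrected) sampling algorithms for lattice gauge theory;
figures of merit are autocorrelation/cost numbers at stated couplings and volumes; no
continuum-physics claim.

Venture `LatticeQCDFlow` (cell pub-lqcd), topic `Scoring`; FANOUT row 4 (`s0-u1-b`, rung S0-B).
Sequel of `Scoring/PairedDrawAcceptance.lean`, which certifies `acc(p,q) = E min(w(x), w(x'))`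
(`w = p/q`, an independent pair of model draws) from `k` pairs with NORMALISED weights.  A code
only holds UNNORMALISED weights `w̃ = c·w` (`c = Z` unknown), and what it prints is the
scale-free RATIO

  `R = ( (1/k) Σ_{i∈s} min(w̃(xᵢ), w̃(x'ᵢ)) ) / ( (1/n) Σ_{j∈s₂} w̃(yⱼ) )`

of the pair-minimum mean to the mean weight over model draws `yⱼ` (the same draws or others —
nothing between the two sums is assumed).  Since `min(cu, cv) = c·min(u,v)`, `R = U/W̄` with `U`,
`W̄` the normalised pair-minimum mean and mean weight (`ratio_scale_free`); `E U = acc`,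
`E W̄ = ∫ p = 1`.  Row 3's `Scoring/AcceptanceMonitorConcentration` (finite frame, all-pairs
statistic) certified the analogous ratio at CHEBYSHEV level; here both factors get EXPONENTIAL
two-sided certificates whose rates see the weight ceiling `W` only linearly: `U` by the previous
file (`kt²/2` below, `kt²/(2(1+Wt/3))` above) and `W̄` by Maurer's lower tail with the second
moment `M₂ = ∫ p²/q = 1/ESS` (`ns²/(2M₂)`) and Bernstein's upper tail (`ns²/(2(M₂ + Ws/3))`);
outside the four tail events the tree's deterministic ratio step
`Scoring.abs_div_sub_lt_of_abs_sub_lt` (`|U − a| < t`, `|W̄ − 1| < s < 1`, `0 ≤ a ≤ 1` ⇒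
`|U/W̄ − a| < (t+s)/(1−s)`) applies.  NEW WORK of the cell (elementary); cited facts BLM 2013
Ex. 2.9 / eq. (2.10), proved in the tree; no definition is introduced.

## What is proved

* §1 `meanAccept_mem_Icc` — `0 ≤ acc(p,q) ≤ 1`; `ratio_scale_free` — `R(w̃) = U/W̄`.
* §2 the mean weight from `n` independent model draws `yⱼ` (`w ∈ [0, W]`, `E w = 1`,
  `E w² = ∫p²/q ≤ M₂`): `meanWeight_lower` `P(Σ w(yⱼ) + ns ≤ n) ≤ exp(−ns²/(2M₂))`,
  `meanWeight_upper` `P(n(1+s) ≤ Σ w(yⱼ)) ≤ exp(−ns²/(2(M₂ + Ws/3)))`.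
* §3 **`printedAcceptance_pairedDraws_confidence`** — `k ≥ 1` pairs, `n ≥ 1` draws, `t > 0`,
  `0 < s < 1`: `P( (t+s)/(1−s) ≤ |R − acc(p,q)| ) ≤ [e^{−kt²/2} + e^{−kt²/(2(1+Wt/3))}]
  + [e^{−ns²/(2M₂)} + e^{−ns²/(2(M₂+Ws/3))}]`.

Reading for row 4 (value-free; no number of ours, no sealed value): the scale-free acceptance
estimate a code prints from its own proposals — pair-minima over mean weight — is a certified
reading of its equilibrium acceptance to within `(t+s)/(1−s)` at an exponential confidence whose
rates are `kt²/2` and `ns²·ESS/2` up to the linear `W`-corrections; two codes' printed estimates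
then compare their acceptances with no parity hypothesis (previous file, §4, verbatim with these
radii).  NOT CLAIMED: the all-pairs U-statistic; estimating `M₂ = 1/ESS` (an input; `M₂ ≤ W`
always works); the realised acceptance rate of a finite chain; any number re-scored.
-/

noncomputable section

namespace Summit.Ventures.LatticeQCDFlow.Scoring.PairedDraws

open MeasureTheory ProbabilityTheory Finset Real Set

variable {Ω : Type*} [MeasurableSpace Ω] {P : Measure Ω} [IsProbabilityMeasure P] {ι : Type*}
variable {X : Type*} [MeasurableSpace X] {μ : Measure X} [SFinite μ]

/-! ## §1 Range of the acceptance; scale-freeness of the printed ratio -/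

omit [SFinite μ] in
/-- **`0 ≤ acc(p, q) ≤ 1`** for a normalised `p ≥ 0` and a normalised model `q > 0` (the integrand
`min(p(a)q(b), p(b)q(a))` lies between `0` and `p(a)q(b)`, which integrates to `1`). [ours] -/
theorem meanAccept_mem_Icc [SFinite μ] {p q : X → ℝ} (hp0 : ∀ y, 0 ≤ p y) (hpm : Measurable p)
    (hpi : Integrable p μ) (hp1 : ∫ y, p y ∂μ = 1) (hq0 : ∀ y, 0 < q y) (hqm : Measurable q)
    (hqi : Integrable q μ) (hq1 : ∫ y, q y ∂μ = 1) :
    (∫ a, ∫ b, min (p a * q b) (p b * q a) ∂μ ∂μ) ∈ Icc (0 : ℝ) 1 := by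
  have hI : Integrable (fun z : X × X => min (p z.1 * q z.2) (p z.2 * q z.1)) (μ.prod μ) := by
    refine Integrable.mono' (hpi.mul_prod hqi) ?_ (Filter.Eventually.of_forall fun z => ?_)
    · exact (((hpm.comp measurable_fst).mul (hqm.comp measurable_snd)).min
        ((hpm.comp measurable_snd).mul (hqm.comp measurable_fst))).aestronglyMeasurable
    · rw [Real.norm_eq_abs, abs_of_nonneg (le_min (mul_nonneg (hp0 _) (hq0 _).le)
        (mul_nonneg (hp0 _) (hq0 _).le))]
      exact min_le_left _ _
  rw [← integral_prod _ hI]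
  refine ⟨integral_nonneg fun z => le_min (mul_nonneg (hp0 _) (hq0 _).le)
    (mul_nonneg (hp0 _) (hq0 _).le), ?_⟩
  calc ∫ z, min (p z.1 * q z.2) (p z.2 * q z.1) ∂(μ.prod μ)
      ≤ ∫ z, p z.1 * q z.2 ∂(μ.prod μ) := integral_mono hI (hpi.mul_prod hqi) fun z => min_le_left _ _
    _ = 1 := by rw [integral_prod_mul, hp1, hq1, mul_one]

omit [MeasurableSpace X] [SFinite μ] in
/-- **The printed ratio is scale-free.**  If the code's weight function is `w̃ = c·(p/q)` with
`c > 0` (unknown normalisation), then its printed ratio — pair-minimum mean over mean weight —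
equals the same ratio formed with the normalised weights `p/q`. [ours] -/
theorem ratio_scale_free {p q wt : X → ℝ} {c : ℝ} (hc : 0 < c) (hwt : ∀ y, wt y = c * (p y / q y))
    {κ : Type*} (s : Finset ι) (s₂ : Finset κ) (u u' : ι → X) (v : κ → X) :
    ((∑ i ∈ s, min (wt (u i)) (wt (u' i))) / s.card) / ((∑ j ∈ s₂, wt (v j)) / s₂.card)
      = ((∑ i ∈ s, min (p (u i) / q (u i)) (p (u' i) / q (u' i))) / s.card)
          / ((∑ j ∈ s₂, p (v j) / q (v j)) / s₂.card) := by
  have e1 : ∑ i ∈ s, min (wt (u i)) (wt (u' i))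
      = c * ∑ i ∈ s, min (p (u i) / q (u i)) (p (u' i) / q (u' i)) := by
    rw [Finset.mul_sum]
    refine Finset.sum_congr rfl fun i _ => ?_
    rw [hwt, hwt, mul_min_of_nonneg _ _ hc.le]
  have e2 : ∑ j ∈ s₂, wt (v j) = c * ∑ j ∈ s₂, p (v j) / q (v j) := by
    rw [Finset.mul_sum]
    exact Finset.sum_congr rfl fun j _ => hwt _
  rw [e1, e2]
  set A : ℝ := ∑ i ∈ s, min (p (u i) / q (u i)) (p (u' i) / q (u' i))
  set B : ℝ := ∑ j ∈ s₂, p (v j) / q (v j)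
  rcases eq_or_ne B 0 with hB | hB
  · simp [hB]
  rcases eq_or_ne (s.card : ℝ) 0 with hk | hk
  · simp [hk]
  rcases eq_or_ne (s₂.card : ℝ) 0 with hn | hn
  · simp [hn]
  field_simp

/-! ## §2 The mean weight from independent model draws -/

omit [MeasurableSpace X] [SFinite μ] in
/-- The normalised weight `p/q` lies in `[0, W]` under `0 ≤ p ≤ Wq`, `q > 0`. [folklore] -/
private theorem weight_mem_Icc {p q : X → ℝ} (hp0 : ∀ y, 0 ≤ p y) (hq0 : ∀ y, 0 < q y) {W : ℝ}
    (hW : ∀ y, p y ≤ W * q y) (y : X) : p y / q y ∈ Icc (0 : ℝ) W :=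
  ⟨div_nonneg (hp0 y) (hq0 y).le, by rw [div_le_iff₀ (hq0 y)]; exact hW y⟩

omit [IsProbabilityMeasure P] [SFinite μ] in
/-- Moments of the normalised weight under model draws: `E w(y) = ∫ p` and `E w(y)² = ∫ p²/q`
(law dictionary). [folklore] -/
private theorem weight_moments {y : Ω → X} (hym : Measurable y) {p q : X → ℝ}
    (hpm : Measurable p) (hq0 : ∀ z, 0 < q z) (hqm : Measurable q)
    (hlaw : Measure.map y P = μ.withDensity fun z => ENNReal.ofReal (q z)) :
    ∫ ω, p (y ω) / q (y ω) ∂P = ∫ z, p z ∂μ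
      ∧ ∫ ω, (p (y ω) / q (y ω)) ^ 2 ∂P = ∫ z, p z ^ 2 / q z ∂μ := by
  constructor
  · rw [ParityLeg.integral_comp_eq_integral_mul_of_map_eq hym (fun z => (hq0 z).le) hqm hlaw
      (F := fun z => p z / q z) (hpm.div hqm)]
    refine integral_congr_ae (Filter.Eventually.of_forall fun z => ?_)
    show p z / q z * q z = p z
    field_simp [(hq0 z).ne']
  · rw [show (fun ω => (p (y ω) / q (y ω)) ^ 2) = fun ω => (fun z => (p z / q z) ^ 2) (y ω)
      from rfl, ParityLeg.integral_comp_eq_integral_mul_of_map_eq hym (fun z => (hq0 z).le) hqm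
      hlaw (F := fun z => (p z / q z) ^ 2) ((hpm.div hqm).pow_const 2)]
    refine integral_congr_ae (Filter.Eventually.of_forall fun z => ?_)
    show (p z / q z) ^ 2 * q z = p z ^ 2 / q z
    field_simp [(hq0 z).ne']

omit [SFinite μ] in
/-- **Mean weight, lower tail (rate `ns²/(2M₂)`, `M₂ = ∫ p²/q = 1/ESS`).**  Independent model
draws `yⱼ`, `j ∈ s₂` (`n = #s₂`), normalised `p ≥ 0` with ceiling `p ≤ Wq`, `∫ p²/q ≤ M₂`; for
`u ≥ 0`: `P( Σ_{j∈s₂} p(yⱼ)/q(yⱼ) + n u ≤ n ) ≤ exp(−n u²/(2M₂))`. [ours] -/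
theorem meanWeight_lower {κ : Type*} {y : κ → Ω → X} (hym : ∀ j, Measurable (y j))
    (hind : iIndepFun y P) {p q : X → ℝ} (hp0 : ∀ z, 0 ≤ p z) (hpm : Measurable p)
    (hp1 : ∫ z, p z ∂μ = 1) (hq0 : ∀ z, 0 < q z) (hqm : Measurable q) {W : ℝ}
    (hW : ∀ z, p z ≤ W * q z) {M₂ : ℝ} (hM : ∫ z, p z ^ 2 / q z ∂μ ≤ M₂)
    (hlaw : ∀ j, Measure.map (y j) P = μ.withDensity fun z => ENNReal.ofReal (q z))
    (s₂ : Finset κ) {u : ℝ} (hu : 0 ≤ u) :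
    P.real {ω | ∑ j ∈ s₂, p (y j ω) / q (y j ω) + s₂.card * u ≤ s₂.card * 1}
      ≤ Real.exp (-(s₂.card * u ^ 2 / (2 * M₂))) := by
  have hind' : iIndepFun (fun j ω => p (y j ω) / q (y j ω)) P :=
    hind.comp (fun _ z => p z / q z) fun _ => hpm.div hqm
  have hLp : ∀ j, MemLp (fun ω => p (y j ω) / q (y j ω)) 2 P := fun j =>
    MemLp.of_bound ((hpm.div hqm).comp (hym j)).aestronglyMeasurable W
      (Filter.Eventually.of_forall fun ω => by
        have h := weight_mem_Icc hp0 hq0 hW (y j ω)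
        rw [Real.norm_eq_abs, abs_of_nonneg h.1]; exact h.2)
  have h0 : ∀ j, 0 ≤ᵐ[P] fun ω => p (y j ω) / q (y j ω) := fun j =>
    Filter.Eventually.of_forall fun ω => (weight_mem_Icc hp0 hq0 hW (y j ω)).1
  have hm : ∀ j, (1 : ℝ) ≤ ∫ ω, p (y j ω) / q (y j ω) ∂P := fun j => by
    rw [(weight_moments (hym j) hpm hq0 hqm (hlaw j)).1, hp1]
  have hσ : ∀ j, ∫ ω, (p (y j ω) / q (y j ω)) ^ 2 ∂P ≤ M₂ := fun j => by
    rw [(weight_moments (hym j) hpm hq0 hqm (hlaw j)).2]; exact hM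
  exact Literature.Probability.Moments.measureReal_sum_add_le_card_mul_le_exp_of_sq_le hind' hLp h0
    hm hσ hu s₂

omit [SFinite μ] in
/-- **Mean weight, upper tail (Bernstein, rate `nu²/(2(M₂ + Wu/3))`).**  Same setting, `M₂ > 0`,
`n = #s₂ ≥ 1`; for `u > 0`: `P( n(1 + u) ≤ Σ_{j∈s₂} p(yⱼ)/q(yⱼ) ) ≤ exp(−n u²/(2(M₂ + W u/3)))`.
[ours] -/
theorem meanWeight_upper {κ : Type*} {y : κ → Ω → X} (hym : ∀ j, Measurable (y j))
    (hind : iIndepFun y P) {p q : X → ℝ} (hp0 : ∀ z, 0 ≤ p z) (hpm : Measurable p)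
    (hp1 : ∫ z, p z ∂μ = 1) (hq0 : ∀ z, 0 < q z) (hqm : Measurable q) {W : ℝ} (hWpos : 0 < W)
    (hW : ∀ z, p z ≤ W * q z) {M₂ : ℝ} (hM0 : 0 < M₂) (hM : ∫ z, p z ^ 2 / q z ∂μ ≤ M₂)
    (hlaw : ∀ j, Measure.map (y j) P = μ.withDensity fun z => ENNReal.ofReal (q z))
    (s₂ : Finset κ) (hn : 0 < s₂.card) {u : ℝ} (hu : 0 < u) :
    P.real {ω | s₂.card * (1 + u) ≤ ∑ j ∈ s₂, p (y j ω) / q (y j ω)}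
      ≤ Real.exp (-(s₂.card * u ^ 2 / (2 * (M₂ + W * u / 3)))) := by
  have hind' : iIndepFun (fun j ω => p (y j ω) / q (y j ω)) P :=
    hind.comp (fun _ z => p z / q z) fun _ => hpm.div hqm
  have hLp : ∀ j, MemLp (fun ω => p (y j ω) / q (y j ω)) 2 P := fun j =>
    MemLp.of_bound ((hpm.div hqm).comp (hym j)).aestronglyMeasurable W
      (Filter.Eventually.of_forall fun ω => by
        have h := weight_mem_Icc hp0 hq0 hW (y j ω)
        rw [Real.norm_eq_abs, abs_of_nonneg h.1]; exact h.2)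
  have hb : ∀ j, ∀ᵐ ω ∂P, p (y j ω) / q (y j ω) ≤ W := fun j =>
    Filter.Eventually.of_forall fun ω => (weight_mem_Icc hp0 hq0 hW (y j ω)).2
  have hm : ∀ j, ∫ ω, p (y j ω) / q (y j ω) ∂P ≤ 1 := fun j => by
    rw [(weight_moments (hym j) hpm hq0 hqm (hlaw j)).1, hp1]
  have hσ : ∀ j, ∫ ω, (p (y j ω) / q (y j ω)) ^ 2 ∂P ≤ M₂ := fun j => by
    rw [(weight_moments (hym j) hpm hq0 hqm (hlaw j)).2]; exact hM
  exact Literature.Probability.Moments.measureReal_card_mul_add_le_sum_le_exp_of_sq_le hind' hLp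
    hWpos hb hm hM0 hσ s₂ hn hu

/-! ## §3 The printed ratio: an exponential certificate -/

/-- **THE PRINTED (SCALE-FREE) ACCEPTANCE ESTIMATE IS A CERTIFIED READING OF `acc(p, q)`.**
`p ≥ 0` normalised, `q > 0` a normalised model density, ceiling `p ≤ Wq`, `∫ p²/q ≤ M₂` (`M₂ > 0`;
`M₂ = W` always works); numerator: `k = #s ≥ 1` independent pairs of independent model draws
`(xᵢ, x'ᵢ)`; denominator: `n = #s₂ ≥ 1` independent model draws `yⱼ` (nothing assumed between the
two families); weights printed with an arbitrary normalisation `w̃ = c·p/q`, `c > 0`.  Then for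
`t > 0`, `0 < s < 1`, the printed ratio `R = ((1/k)Σ min(w̃(xᵢ), w̃(x'ᵢ)))/((1/n)Σ w̃(yⱼ))`
satisfies `P( (t+s)/(1−s) ≤ |R − acc(p,q)| ) ≤ [exp(−kt²/2) + exp(−kt²/(2(1+Wt/3)))]
+ [exp(−ns²/(2M₂)) + exp(−ns²/(2(M₂+Ws/3)))]`. [ours] -/
theorem printedAcceptance_pairedDraws_confidence {x x' : ι → Ω → X}
    (hxm : ∀ i, Measurable (x i)) (hxm' : ∀ i, Measurable (x' i))
    (hin : ∀ i, IndepFun (x i) (x' i) P) (hpair : iIndepFun (fun i ω => (x i ω, x' i ω)) P)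
    {κ : Type*} {y : κ → Ω → X} (hym : ∀ j, Measurable (y j)) (hindy : iIndepFun y P)
    {p q : X → ℝ} (hp0 : ∀ z, 0 ≤ p z) (hpm : Measurable p) (hpi : Integrable p μ)
    (hp1 : ∫ z, p z ∂μ = 1) (hq0 : ∀ z, 0 < q z) (hqm : Measurable q) (hqi : Integrable q μ)
    (hq1 : ∫ z, q z ∂μ = 1) {W : ℝ} (hW : ∀ z, p z ≤ W * q z) {M₂ : ℝ} (hM0 : 0 < M₂)
    (hM : ∫ z, p z ^ 2 / q z ∂μ ≤ M₂)
    (hlaw : ∀ i, Measure.map (x i) P = μ.withDensity fun z => ENNReal.ofReal (q z))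
    (hlaw' : ∀ i, Measure.map (x' i) P = μ.withDensity fun z => ENNReal.ofReal (q z))
    (hlawy : ∀ j, Measure.map (y j) P = μ.withDensity fun z => ENNReal.ofReal (q z))
    {wt : X → ℝ} {c : ℝ} (hc : 0 < c) (hwt : ∀ z, wt z = c * (p z / q z))
    (s : Finset ι) (s₂ : Finset κ) (hs : 0 < s.card) (hn : 0 < s₂.card) {t u : ℝ} (ht : 0 < t)
    (hu : 0 < u) (hu1 : u < 1) :
    P.real {ω | (t + u) / (1 - u)
        ≤ |((∑ i ∈ s, min (wt (x i ω)) (wt (x' i ω))) / s.card)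
              / ((∑ j ∈ s₂, wt (y j ω)) / s₂.card)
            - ∫ a, ∫ b, min (p a * q b) (p b * q a) ∂μ ∂μ|}
      ≤ (Real.exp (-(s.card * t ^ 2 / 2)) + Real.exp (-(s.card * t ^ 2 / (2 * (1 + W * t / 3)))))
        + (Real.exp (-(s₂.card * u ^ 2 / (2 * M₂)))
          + Real.exp (-(s₂.card * u ^ 2 / (2 * (M₂ + W * u / 3))))) := by
  have hWpos : 0 < W := by
    by_contra hW0
    have hp : ∀ z, p z = 0 := fun z => le_antisymm
      ((hW z).trans (mul_nonpos_of_nonpos_of_nonneg (not_lt.mp hW0) (hq0 z).le)) (hp0 z)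
    simp [hp] at hp1
  have hacc := meanAccept_mem_Icc hp0 hpm hpi hp1 hq0 hqm hqi hq1
  have hU := acceptance_pairedDraws_confidence hxm hxm' hin hpair hp0 hpm hpi hp1 hq0 hqm hqi hW
    hlaw hlaw' s hs ht
  have hWlo := meanWeight_lower hym hindy hp0 hpm hp1 hq0 hqm hW hM hlawy s₂ hu.le
  have hWup := meanWeight_upper hym hindy hp0 hpm hp1 hq0 hqm hWpos hW hM0 hM hlawy s₂ hn hu
  have hk : (0 : ℝ) < s.card := by exact_mod_cast hs
  have hn' : (0 : ℝ) < s₂.card := by exact_mod_cast hn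
  set acc : ℝ := ∫ a, ∫ b, min (p a * q b) (p b * q a) ∂μ ∂μ with hacc_def
  set U : Ω → ℝ := fun ω =>
    (∑ i ∈ s, min (p (x i ω) / q (x i ω)) (p (x' i ω) / q (x' i ω))) / s.card with hUdef
  set Sw : Ω → ℝ := fun ω => ∑ j ∈ s₂, p (y j ω) / q (y j ω) with hSw
  -- scale-freeness: the printed ratio is `U / (Sw/n)`
  have hR : ∀ ω, ((∑ i ∈ s, min (wt (x i ω)) (wt (x' i ω))) / s.card)
        / ((∑ j ∈ s₂, wt (y j ω)) / s₂.card) = U ω / (Sw ω / s₂.card) := fun ω =>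
    ratio_scale_free hc hwt s s₂ (fun i => x i ω) (fun i => x' i ω) (fun j => y j ω)
  have hsub : {ω | (t + u) / (1 - u)
        ≤ |((∑ i ∈ s, min (wt (x i ω)) (wt (x' i ω))) / s.card)
              / ((∑ j ∈ s₂, wt (y j ω)) / s₂.card) - acc|}
      ⊆ {ω | t ≤ |U ω - acc|}
        ∪ ({ω | Sw ω + s₂.card * u ≤ s₂.card * 1} ∪ {ω | s₂.card * (1 + u) ≤ Sw ω}) := by
    intro ω hω
    simp only [mem_setOf_eq, mem_union] at hω ⊢
    rw [hR ω] at hω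
    by_contra hcon
    simp only [not_or, not_le] at hcon
    obtain ⟨h1, h2, h3⟩ := hcon
    -- `|W̄ − 1| < u`
    have hWb : |Sw ω / s₂.card - 1| < u := by
      rw [abs_lt]
      constructor
      · have : s₂.card * (1 - u) < Sw ω := by linarith
        rw [← lt_div_iff₀' hn'] at this
        linarith
      · have : Sw ω < s₂.card * (1 + u) := h3
        rw [← div_lt_iff₀' hn'] at this
        linarith
    have key := abs_div_sub_lt_of_abs_sub_lt hacc.1 hacc.2 hu1 h1 hWb
    linarith
  calc P.real {ω | (t + u) / (1 - u)
          ≤ |((∑ i ∈ s, min (wt (x i ω)) (wt (x' i ω))) / s.card)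
                / ((∑ j ∈ s₂, wt (y j ω)) / s₂.card) - acc|}
      ≤ P.real ({ω | t ≤ |U ω - acc|}
          ∪ ({ω | Sw ω + s₂.card * u ≤ s₂.card * 1} ∪ {ω | s₂.card * (1 + u) ≤ Sw ω})) :=
        measureReal_mono hsub
    _ ≤ P.real {ω | t ≤ |U ω - acc|}
          + P.real ({ω | Sw ω + s₂.card * u ≤ s₂.card * 1} ∪ {ω | s₂.card * (1 + u) ≤ Sw ω}) :=
        measureReal_union_le _ _
    _ ≤ P.real {ω | t ≤ |U ω - acc|}
          + (P.real {ω | Sw ω + s₂.card * u ≤ s₂.card * 1}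
            + P.real {ω | s₂.card * (1 + u) ≤ Sw ω}) :=
        add_le_add le_rfl (measureReal_union_le _ _)
    _ ≤ _ := add_le_add hU (add_le_add hWlo hWup)

end Summit.Ventures.LatticeQCDFlow.Scoring.PairedDraws

end
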